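import Summits.ABC.IUTFork.Joshi.ThetaLociPadicLogGeneral
import HarnessLib

/-!
# Joshi, *Arithmetic Teichmüller Spaces III* (arXiv:2401.13508v4) §9.8.2: the four READING PREDICATES of
# `Joshi/ThetaLociSizes.lean` DERIVED from explicit readings — Cor. 9.8.2.6 (intrinsic part), Rmk. 9.8.2.3, (9.8.2.1)

Proof-only companion of `Joshi/ThetaLociSizes.lean` (p429205) over the same signature `ATS3.TensorPacketLociDatum`
(p428903), sequel of `Joshi/ThetaLociPadicLogGeneral.lean` (p434712; Lemma 9.8.2.7 for every `p`-adic field) — abc-iut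
cell, branch E, rung LADDER-ABC:A2.E; seat abc-iut-E-t22, slot T-22, generation 2 (E-plan-2 RULINGS 09:15Z (3): «DERIVABLE
rows of its own §9.8 files»). Render `HOME/lit/renders/Joshi-arxiv-2401.13508/pNNNN.txt`, «p.N l.M» = line M of page N.

`ThetaLociSizes` TYPED four sentences of §9.8.2 as `Prop`-valued reading predicates over the ABSTRACT collation signature
(intrinsic absolute values `nrm y w`, classes `ξ_{y,w} = xi y w`, unit classes `one y w`, collation maps `coll y w` into
the compact log-shell `shell w`): `UnitNormOffSS` (second `=` of (9.8.2.1), p.117 l.15–36), `OneUnitNorm` (Rmk. 9.8.2.3,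
p.117 l.63–80), `ProdSizeBounded` / `PlaceSizeBounded` (Cor. 9.8.2.6, intrinsic part, p.117 l.127–158 — FLAG (iii): print's
proof «clear from Corollary 9.8.1.3» controls CODOMAIN norms, the definitions (9.8.2.4)/(9.8.2.5) take INTRINSIC norms).
HERE each is DERIVED from an explicit READING — hypotheses stated inline (no new `Prop` definitions, no claim asserted):

1. **Cor. 9.8.2.6, intrinsic part** (`placeSizeBounded_of_collationReading`, `prodSizeBounded_of_collationReading`,
   `…_of_continuousCollationReading`): IF the intrinsic absolute values are read THROUGH the collation maps by a place-wise
   gauge `ν_w : V_w → ℝ≥0` on the standard coordinate space, `|h|_{K_{y_w}} = ν_w(ι h)` for every collation map `ι` at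
   `(y, w)` — i.e. the collation isomorphisms of Prop. 9.7.5.1 are ISOMETRIC for the norms print compares — and `ν_w` is
   bounded on the log-shell `I(L′_w)` (automatic for a continuous gauge: Cor. 9.8.1.3's compactness, p.116 l.63 – p.117
   l.6), THEN the intrinsic sizes (9.8.2.4)/(9.8.2.5) and every `w`-component are bounded. This is print's proof made
   explicit: «clear from Corollary 9.8.1.3» is exactly the isometric reading. Both horns of the cell's dictionary question
   D-10 satisfy it: Galois-induced collation (N) is valuation-preserving (abc-iut-E-t38 p433852) and the prime-to-`p`
   power moves of the wide reading (W) act on the additive log-shell container as `p`-adic UNIT scalings (abc-iut-E-t18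
   p433903 `TestCollationUnitMoves`), hence norm-preserving — recorded, not imported (R14).
2. **Rmk. 9.8.2.3** (`oneUnitNorm_of_padicReading`): IF the norm of the unit class at `(y, w)` is READ in a `p_w`-adic
   field as `‖p*_w⁻¹ · log(1 + p*_w)‖` ((9.7.2.2): `log_BK = p*⁻¹·log_p` on `1 + p*𝒪`, abc-iut-E-t21's
   `LogBKPrincipalUnits`), THEN it equals `1` — by Lemma 9.8.2.7, now the theorem
   `norm_pStar_inv_mul_unitLog_one_add_pStar` (p434712) for every `p`-adic field.
3. **(9.8.2.1), second equality** (`unitNormOffSS_of_oneUnitNorm`): IF, as (9.7.4.2) prints (p.112 l.12–19), the class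
   `ξ_{y,w}` at a place `w ∉ 𝕍^{odd,ss}` IS the unit class, THEN `UnitNormOffSS` follows from `OneUnitNorm`; with 2.,
   from the `p`-adic reading (`unitNormOffSS_of_padicReading`), and (9.8.2.1) holds as a `finprod` identity
   (`finprod_nrm_xi_of_padicReading`).
4. **(9.9.2)–(9.9.4) on T-22's own projection** `toLocusDatum` (the one abc-iut-E-t23's `LogVolumesHullsJoint` p433591
   proves equal to his): IF the standard classes are READ as `|ξ_{w,j}| = ‖p*⁻¹·log(1 + p*·q^{1/2ℓ}_{w;j})‖` in `p_w`-adic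
   fields `L′_{w,j}` with `‖q^{1/2ℓ}_{w;j}‖ = |q_w^{1/2ℓ}|^{j²/ℓ*²}` (Thm. 4.2.2.1 (4) in print's (9.9.4) normalisation),
   THEN E-t4's `ValuationScaling` holds for the projection (`toLocusDatum_valuationScaling_of_logReading`), and with 1.
   E-t4's Thm. 9.9.1 `w`-component follows with NO reading predicate of `ThetaLociSizes` left as a hypothesis
   (`fundamentalEstimateSup_of_readings`).
Net: after this file every reading predicate of `ThetaLociSizes` is a theorem MODULO a named dictionary reading
(isometric collation / (9.7.2.2) / (9.7.4.2) / (9.9.4)); which reading OUR side realises is the dictionary's business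
(`Joshi/Dictionary*.lean`, E-PLAN R14), not asserted here. Classical bookkeeping; nothing of [IUTchIII] Cor. 3.12 is
asserted; typed ≠ proved ≠ endorsed; no side taken on any author. [claim: Joshi2024ATS3, status: disputed] marks
docstrings whose DISPLAY is Joshi's.
-/

noncomputable section

open Set Metric

namespace Summit.ABC.IUTFork.Joshi.ATS3

namespace TensorPacketLociDatum

open Literature.IUT.LogVolume

variable {W : Type} {V : W → Type} [∀ w, TopologicalSpace (V w)] {TJ TM : Type} [TopologicalSpace TJ]
  [TopologicalSpace TM] (C : TensorPacketLociDatum W V TJ TM)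

/-! ## 1. Cor. 9.8.2.6, intrinsic part, under the isometric-collation reading -/

section CollationReading

variable {ν : ∀ w, V w → ℝ} {M : W → ℝ}

/-- Under the reading «`|h|_{K_{y_w}} = ν_w(ι h)` for every collation map `ι` at `(y, w)`» and a bound `M_w` of the gauge
on the log-shell, EVERY intrinsic norm at `w` is `≤ M_w` (collation maps exist — amphoricity, `coll_nonempty` — and land
in the shell, `coll_mem`). [folklore] -/
theorem nrm_le_of_collationReading (hν : ∀ y w ι, ι ∈ C.coll y w → ∀ h, C.nrm y w h = ν w (ι h))
    (hM : ∀ w x, x ∈ C.shell w → ν w x ≤ M w) (y : C.Y) (w : W) (h : C.H y w) : C.nrm y w h ≤ M w := by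
  obtain ⟨ι, hι⟩ := C.coll_nonempty y w
  rw [hν y w ι hι h]
  exact hM w _ (C.coll_mem y w ι hι h)

/-- Under the same reading with a nonnegative gauge, intrinsic norms are nonnegative. [folklore] -/
theorem nrm_nonneg_of_collationReading (hν : ∀ y w ι, ι ∈ C.coll y w → ∀ h, C.nrm y w h = ν w (ι h))
    (hν0 : ∀ w x, 0 ≤ ν w x) (y : C.Y) (w : W) (h : C.H y w) : 0 ≤ C.nrm y w h := by
  obtain ⟨ι, hι⟩ := C.coll_nonempty y w
  rw [hν y w ι hι h]
  exact hν0 w _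

/-- **Cor. 9.8.2.6 per place, intrinsic form, DERIVED under the isometric-collation reading**: the `w`-component size
(9.8.2.4) is bounded (by `M_w^{ℓ*}`). [claim: Joshi2024ATS3, status: disputed] -/
theorem placeSizeBounded_of_collationReading (hν : ∀ y w ι, ι ∈ C.coll y w → ∀ h, C.nrm y w h = ν w (ι h))
    (hν0 : ∀ w x, 0 ≤ ν w x) (hM : ∀ w x, x ∈ C.shell w → ν w x ≤ M w) (w : W) : C.PlaceSizeBounded w := by
  refine ⟨M w ^ C.lstar, ?_⟩
  rintro _ ⟨z, rfl⟩
  calc ∏ i : Fin C.lstar, C.nrm (C.pt z i) w (C.xi (C.pt z i) w) ≤ ∏ _i : Fin C.lstar, M w :=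
        Finset.prod_le_prod (fun i _ => C.nrm_nonneg_of_collationReading hν hν0 (C.pt z i) w _)
          fun i _ => C.nrm_le_of_collationReading hν hM (C.pt z i) w _
    _ = M w ^ C.lstar := by rw [Finset.prod_const, Finset.card_univ, Fintype.card_fin]

/-- Every class norm (9.8.2.1) is bounded by `∏_{w ∈ 𝕍^{odd,ss}} M_w` under the reading. [folklore] -/
theorem classNorm_le_of_collationReading (hν : ∀ y w ι, ι ∈ C.coll y w → ∀ h, C.nrm y w h = ν w (ι h))
    (hν0 : ∀ w x, 0 ≤ ν w x) (hM : ∀ w x, x ∈ C.shell w → ν w x ≤ M w) (y : C.Y) :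
    C.classNorm y ≤ ∏ w ∈ C.Wss, M w :=
  Finset.prod_le_prod (fun w _ => C.nrm_nonneg_of_collationReading hν hν0 y w _)
    fun w _ => C.nrm_le_of_collationReading hν hM y w _

/-- Class norms are nonnegative under the reading. [folklore] -/
theorem classNorm_nonneg_of_collationReading (hν : ∀ y w ι, ι ∈ C.coll y w → ∀ h, C.nrm y w h = ν w (ι h))
    (hν0 : ∀ w x, 0 ≤ ν w x) (y : C.Y) : 0 ≤ C.classNorm y :=
  Finset.prod_nonneg fun w _ => C.nrm_nonneg_of_collationReading hν hν0 y w _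

/-- **Cor. 9.8.2.6, intrinsic part, DERIVED under the isometric-collation reading**: both suprema (9.8.2.4)
`|Θ̃^{Ĩ}_Joshi|` and (9.8.2.5) `|Θ̃^{Ĩ}_Mochizuki|` are over bounded sets — the first by `(∏_{w ∈ 𝕍^{odd,ss}} M_w)^{ℓ*}`, the
second by `∏_j (∏_w M_w)^{j+1}` (the unit classes at `a < j` are collated into the same shells). This is print's «clear from
Corollary 9.8.1.3» with the step «intrinsic norm = codomain norm» made an explicit hypothesis. [claim: Joshi2024ATS3, status: disputed] -/
theorem prodSizeBounded_of_collationReading (hν : ∀ y w ι, ι ∈ C.coll y w → ∀ h, C.nrm y w h = ν w (ι h))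
    (hν0 : ∀ w x, 0 ≤ ν w x) (hM : ∀ w x, x ∈ C.shell w → ν w x ≤ M w) : C.ProdSizeBounded := by
  refine ⟨⟨(∏ w ∈ C.Wss, M w) ^ C.lstar, ?_⟩, ⟨∏ i : Fin C.lstar, (∏ w ∈ C.Wss, M w) ^ ((i : ℕ) + 2), ?_⟩⟩
  · rintro _ ⟨z, rfl⟩
    calc C.tupleNormJ z = ∏ i : Fin C.lstar, C.classNorm (C.pt z i) := rfl
      _ ≤ ∏ _i : Fin C.lstar, ∏ w ∈ C.Wss, M w :=
          Finset.prod_le_prod (fun i _ => C.classNorm_nonneg_of_collationReading hν hν0 (C.pt z i))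
            fun i _ => C.classNorm_le_of_collationReading hν hν0 hM (C.pt z i)
      _ = (∏ w ∈ C.Wss, M w) ^ C.lstar := by rw [Finset.prod_const, Finset.card_univ, Fintype.card_fin]
  · rintro _ ⟨z, rfl⟩
    unfold tupleNormM
    refine Finset.prod_le_prod (fun i _ => Finset.prod_nonneg fun a _ => Finset.prod_nonneg fun w _ =>
      C.nrm_nonneg_of_collationReading hν hν0 (C.extAt z i a) w _) fun i _ => ?_
    calc ∏ a : Fin ((i : ℕ) + 2), ∏ w ∈ C.Wss, C.nrm (C.extAt z i a) w (C.xiM z i a w)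
        ≤ ∏ _a : Fin ((i : ℕ) + 2), ∏ w ∈ C.Wss, M w :=
          Finset.prod_le_prod
            (fun a _ => Finset.prod_nonneg fun w _ => C.nrm_nonneg_of_collationReading hν hν0 (C.extAt z i a) w _)
            fun a _ => Finset.prod_le_prod (fun w _ => C.nrm_nonneg_of_collationReading hν hν0 (C.extAt z i a) w _)
              fun w _ => C.nrm_le_of_collationReading hν hM (C.extAt z i a) w _
      _ = (∏ w ∈ C.Wss, M w) ^ ((i : ℕ) + 2) := by rw [Finset.prod_const, Finset.card_univ, Fintype.card_fin]

end CollationReading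

section ContinuousGauge

variable {ν : ∀ w, V w → ℝ}

/-- A continuous gauge is bounded on each (compact, Cor. 9.8.1.3) log-shell by its supremum there. [folklore] -/
theorem gauge_le_sSup_of_continuous (hcont : ∀ w, Continuous (ν w)) (w : W) (x : V w) (hx : x ∈ C.shell w) :
    ν w x ≤ sSup (ν w '' C.shell w) :=
  le_csSup ((C.shell_compact w).bddAbove_image (hcont w).continuousOn) ⟨x, hx, rfl⟩

/-- **Cor. 9.8.2.6 per place, intrinsic form, for a CONTINUOUS isometric-collation reading** — the bound comes from the
compactness of the log-shell (Cor. 9.8.1.3), verbatim print's argument. [claim: Joshi2024ATS3, status: disputed] -/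
theorem placeSizeBounded_of_continuousCollationReading
    (hν : ∀ y w ι, ι ∈ C.coll y w → ∀ h, C.nrm y w h = ν w (ι h)) (hν0 : ∀ w x, 0 ≤ ν w x)
    (hcont : ∀ w, Continuous (ν w)) (w : W) : C.PlaceSizeBounded w :=
  C.placeSizeBounded_of_collationReading hν hν0 (fun w x hx => C.gauge_le_sSup_of_continuous hcont w x hx) w

/-- **Cor. 9.8.2.6, intrinsic part, for a CONTINUOUS isometric-collation reading.** [claim: Joshi2024ATS3, status: disputed] -/
theorem prodSizeBounded_of_continuousCollationReading
    (hν : ∀ y w ι, ι ∈ C.coll y w → ∀ h, C.nrm y w h = ν w (ι h)) (hν0 : ∀ w x, 0 ≤ ν w x)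
    (hcont : ∀ w, Continuous (ν w)) : C.ProdSizeBounded :=
  C.prodSizeBounded_of_collationReading hν hν0 fun w x hx => C.gauge_le_sSup_of_continuous hcont w x hx

end ContinuousGauge

/-! ## 2. Rmk. 9.8.2.3 and (9.8.2.1) under the `p`-adic reading of the unit class -/

/-- **(9.8.2.1), second equality, from Rmk. 9.8.2.3**: if, as (9.7.4.2) prints (p.112 l.12–19), the class `ξ_{y,w}` at a
place `w ∉ 𝕍^{odd,ss}` IS the unit class `(1+p*_w)^{1/p^n}`, then `UnitNormOffSS` follows from `OneUnitNorm`.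
[claim: Joshi2024ATS3, status: disputed] -/
theorem unitNormOffSS_of_oneUnitNorm (hxi : ∀ (y : C.Y) (w : W), w ∉ C.Wss → C.xi y w = C.one y w)
    (h1 : C.OneUnitNorm) : C.UnitNormOffSS := fun y w hw => by
  rw [hxi y w hw]; exact h1 y w

section PadicReading

variable (pw : W → ℕ) [hpw : ∀ w, Fact (pw w).Prime] (K : W → Type) [∀ w, NontriviallyNormedField (K w)]
  [instK : ∀ w, NormedAlgebra ℚ_[pw w] (K w)] [instU : ∀ w, IsUltrametricDist (K w)] [instC : ∀ w, CompleteSpace (K w)]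

/-- **Rmk. 9.8.2.3 DERIVED under the `p`-adic reading of the unit class**: if at every `(y, w)` the intrinsic norm of the
unit class is READ in a `p_w`-adic field `K_w` (any complete ultrametric normed `ℚ_{p_w}`-algebra — the residue fields
`K_{y_w} ≅ L′_w` up to isometry) as `‖p*_w⁻¹ · log(1 + p*_w)‖` ((9.7.2.2) `log_BK = p*⁻¹·log_p`), then it equals `1`:
Lemma 9.8.2.7 for every `p`-adic field (p434712). [claim: Joshi2024ATS3, status: disputed] -/
theorem oneUnitNorm_of_padicReading
    (hone : ∀ (y : C.Y) (w : W), C.nrm y w (C.one y w) =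
      ‖(((pStar (pw w) : ℕ) : K w))⁻¹ * unitLog (1 + ((pStar (pw w) : ℕ) : K w))‖) :
    C.OneUnitNorm := fun y w => by
  rw [hone y w]; exact norm_pStar_inv_mul_unitLog_one_add_pStar (pw w) (K w)

/-- Hence, with (9.7.4.2)'s identification of the off-`𝕍^{odd,ss}` classes with unit classes, `UnitNormOffSS` — the second
`=` of (9.8.2.1). [claim: Joshi2024ATS3, status: disputed] -/
theorem unitNormOffSS_of_padicReading (hxi : ∀ (y : C.Y) (w : W), w ∉ C.Wss → C.xi y w = C.one y w)
    (hone : ∀ (y : C.Y) (w : W), C.nrm y w (C.one y w) =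
      ‖(((pStar (pw w) : ℕ) : K w))⁻¹ * unitLog (1 + ((pStar (pw w) : ℕ) : K w))‖) :
    C.UnitNormOffSS :=
  C.unitNormOffSS_of_oneUnitNorm hxi (C.oneUnitNorm_of_padicReading pw K hone)

/-- … so (9.8.2.1) holds as printed: the product over ALL places is the finite product over `𝕍^{odd,ss}`
(`finprod_nrm_xi` of `ThetaLociSizes` with its hypothesis discharged). [claim: Joshi2024ATS3, status: disputed] -/
theorem finprod_nrm_xi_of_padicReading (hxi : ∀ (y : C.Y) (w : W), w ∉ C.Wss → C.xi y w = C.one y w)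
    (hone : ∀ (y : C.Y) (w : W), C.nrm y w (C.one y w) =
      ‖(((pStar (pw w) : ℕ) : K w))⁻¹ * unitLog (1 + ((pStar (pw w) : ℕ) : K w))‖) (y : C.Y) :
    ∏ᶠ w, C.nrm y w (C.xi y w) = C.classNorm y :=
  C.finprod_nrm_xi (C.unitNormOffSS_of_padicReading pw K hxi hone) y

/-- … and Rmk. 9.8.2.3's consequence: the two product sizes (9.8.2.4)/(9.8.2.5) coincide (`prodSizeM_eq_prodSizeJ` of
`ThetaLociSizes` with its hypothesis discharged). [claim: Joshi2024ATS3, status: disputed] -/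
theorem prodSizeM_eq_prodSizeJ_of_padicReading
    (hone : ∀ (y : C.Y) (w : W), C.nrm y w (C.one y w) =
      ‖(((pStar (pw w) : ℕ) : K w))⁻¹ * unitLog (1 + ((pStar (pw w) : ℕ) : K w))‖) :
    C.prodSizeM = C.prodSizeJ :=
  C.prodSizeM_eq_prodSizeJ (C.oneUnitNorm_of_padicReading pw K hone)

end PadicReading

/-! ## 3. (9.9.2)–(9.9.4) on T-22's projection and Thm. 9.9.1 at `w` from readings only -/

section LogReading

variable (p : ℕ) [hp : Fact p.Prime] (K : ℕ → Type) [∀ n, NontriviallyNormedField (K n)]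
  [instK : ∀ n, NormedAlgebra ℚ_[p] (K n)] [instU : ∀ n, IsUltrametricDist (K n)] [instC : ∀ n, CompleteSpace (K n)]

/-- **(9.9.2)–(9.9.3) on the standard norms**: if at the place `w` (over `p = p_w`) the standard class norms are READ as
`|ξ_{w,j}| = ‖p*⁻¹ · log_{L′_{w,j}}(1 + p*·q_j)‖` in `p`-adic fields `L′_{w,j} = K j` with `q_j = q^{1/2ℓ}_{w;j} ∈ 𝒪`
((9.7.2.2) + p.120 l.106–130), then `|ξ_{w,j}| = ‖q_j‖` (Lemma 9.8.2.7, p434712). [claim: Joshi2024ATS3, status: disputed] -/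
theorem standardNorm_eq_of_logReading (w : W) (q : ∀ i : Fin C.lstar, K i)
    (hstd : ∀ i : Fin C.lstar, C.standardNorm w i =
      ‖(((pStar p : ℕ) : K i))⁻¹ * unitLog (1 + ((pStar p : ℕ) : K i) * q i)‖)
    (hq : ∀ i, ‖q i‖ ≤ 1) (i : Fin C.lstar) : C.standardNorm w i = ‖q i‖ := by
  rw [hstd i]; exact norm_pStar_inv_mul_unitLog_one_add_mul p (K i) (hq i)

/-- **E-t4's `ValuationScaling` for T-22's projection `toLocusDatum`, DERIVED from readings**: the log-reading of the
standard norms + the root law `‖q^{1/2ℓ}_{w;j}‖ = |q_w^{1/2ℓ}|^{j²/ℓ*²}` ((9.9.4) in print's normalisation; integrality of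
`q_j` follows since `|q_w^{1/2ℓ}| < 1`). [claim: Joshi2024ATS3, status: disputed] -/
theorem toLocusDatum_valuationScaling_of_logReading (w : W) (q : ∀ i : Fin C.lstar, K i)
    (hstd : ∀ i : Fin C.lstar, C.standardNorm w i =
      ‖(((pStar p : ℕ) : K i))⁻¹ * unitLog (1 + ((pStar p : ℕ) : K i) * q i)‖)
    (qroot : ℝ) (hq0 : 0 < qroot) (hq1 : qroot < 1) (hullVol : ℝ)
    (hroot : ∀ i, ‖q i‖ = qroot ^ LocusDatum.scalingExponent C.lstar i) :
    (C.toLocusDatum w qroot hq0 hq1 hullVol).ValuationScaling := by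
  intro i
  have hq : ∀ i, ‖q i‖ ≤ 1 := fun i => by
    rw [hroot i]; exact Real.rpow_le_one hq0.le hq1.le (LocusDatum.scalingExponent_nonneg i)
  change C.standardNorm w i = qroot ^ LocusDatum.scalingExponent C.lstar i
  rw [C.standardNorm_eq_of_logReading p K w q hstd hq i, hroot i]

/-- **Thm. 9.9.1, `w`-component, for T-22's projection FROM READINGS ONLY**: isometric continuous collation reading (⇒ Cor.
9.8.2.6 intrinsic at `w`) + log-reading of the standard norms + the root law ⇒ `|q_w^{1/2ℓ}|^{ℓ*} ≤ |Θ̃_{Joshi,w}|`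
(E-t4's `fundamentalEstimateSup_of` through `ThetaLociSizes.fundamentalEstimateSup_of_scaling`, no reading predicate
of `ThetaLociSizes` left as a hypothesis). [claim: Joshi2024ATS3, status: disputed] -/
theorem fundamentalEstimateSup_of_readings {ν : ∀ w, V w → ℝ}
    (hν : ∀ y w ι, ι ∈ C.coll y w → ∀ h, C.nrm y w h = ν w (ι h)) (hν0 : ∀ w x, 0 ≤ ν w x)
    (hcont : ∀ w, Continuous (ν w)) (w : W) (q : ∀ i : Fin C.lstar, K i)
    (hstd : ∀ i : Fin C.lstar, C.standardNorm w i =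
      ‖(((pStar p : ℕ) : K i))⁻¹ * unitLog (1 + ((pStar p : ℕ) : K i) * q i)‖)
    (qroot : ℝ) (hq0 : 0 < qroot) (hq1 : qroot < 1) (hullVol : ℝ)
    (hroot : ∀ i, ‖q i‖ = qroot ^ LocusDatum.scalingExponent C.lstar i) :
    (C.toLocusDatum w qroot hq0 hq1 hullVol).FundamentalEstimateSup :=
  C.fundamentalEstimateSup_of_scaling w (C.placeSizeBounded_of_continuousCollationReading hν hν0 hcont w) qroot hq0
    hq1 hullVol (C.toLocusDatum_valuationScaling_of_logReading p K w q hstd qroot hq0 hq1 hullVol hroot)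

end LogReading

end TensorPacketLociDatum

end Summit.ABC.IUTFork.Joshi.ATS3

end
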